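import Mathlib.Analysis.Convex.Join
import Literature.Analysis.Convexity.PLGeneralPosition
import HarnessLib

/-!
# Cone complexes from a visible apex

The cone `c * ℬ` on a geometric simplicial complex `ℬ` (Mathlib's `Geometry.SimplicialComplex`)
from an apex `c` is again a geometric simplicial complex as soon as `ℬ` is **visible** from `c`
(`VisibleFrom c ℬ`): every face lies in a hyperplane `{ℓ = m}` supporting the whole complex
(`ℓ ≤ m` on all faces) with `ℓ c < m`.  This covers the two situations of the engulfing
programme: a complex inside an affine subspace not containing `c`
(`visibleFrom_of_subset_affineSubspace`; the cone shadows of `ConeShadow.lean` /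
`StretchSequence.lean`), and a complex made of faces of a convex polytope on the facets not
through the vertex `c` (the recursive cone triangulation of prisms `σ × [t, t']` of the
homotopy track, for which every convex polytope is the cone from any of its vertices over the
complementary boundary).

* `VisibleFrom.param_unique` — on segments from the apex the parameter of a point is unique
  (evaluate the two supporting functionals); hence cones over faces meet as cones
  (`VisibleFrom.convexHull_insert_inter_subset`) and a cone meets the base in its base face
  (`VisibleFrom.convexHull_insert_inter_base_subset`); the apex is off the affine span of every
  face (`VisibleFrom.apex_notMem_affineSpan`), so `{c} ∪ τ` is affinely independent.
* `coneComplex c ℬ h` — **the cone complex**: faces `ℬ ∪ {c * τ} ∪ {{c}}`, with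
  `coneComplex_space = {c} ∪ ⋃ τ, conv ({c} ∪ τ)`.

Rourke–Sanderson (1972), 2.8 (cones) / Rushing (1973), §1.6.B.  Everything is proved; no named
facts.

## References

* C. P. Rourke, B. J. Sanderson, *Introduction to Piecewise-Linear Topology*, Springer (1972),
  Ch. 2 (joins and cones). [RourkeSanderson1972]
* T. B. Rushing, *Topological Embeddings*, Academic Press (1973), §1.6.B. [Rushing1973]
-/

open Set Function

noncomputable section

namespace Literature.Topology.FourManifolds

open Literature.Analysis.Convexity

variable {E : Type*} [NormedAddCommGroup E] [NormedSpace ℝ E] [DecidableEq E]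

/-- **Visibility of a complex from an apex.**  Every face `τ` of `ℬ` lies in a hyperplane
`{ℓ = m}` which supports the whole complex (`ℓ ≤ m` on every face) and strictly separates the
apex (`ℓ c < m`).  This holds for a complex inside an affine subspace not containing `c`
(`ℓ` vanishing there, `ℓ c = -1`, `m = 0`) and for a complex made of faces of a convex polytope
not containing the vertex `c` (the facet-defining functionals). [folklore] -/
def VisibleFrom (c : E) (ℬ : Geometry.SimplicialComplex ℝ E) : Prop :=
  ∀ τ ∈ ℬ.faces, ∃ (ℓ : E →ᵃ[ℝ] ℝ) (m : ℝ), ℓ c < m ∧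
    (∀ x ∈ convexHull ℝ (τ : Set E), ℓ x = m) ∧
    ∀ τ' ∈ ℬ.faces, ∀ x ∈ convexHull ℝ (τ' : Set E), ℓ x ≤ m

namespace VisibleFrom

variable {c : E} {ℬ : Geometry.SimplicialComplex ℝ E}

omit [DecidableEq E] in
/-- The apex lies on no face of a visible complex. [folklore] -/
theorem apex_notMem_convexHull (h : VisibleFrom c ℬ) {τ : Finset E} (hτ : τ ∈ ℬ.faces) :
    c ∉ convexHull ℝ (τ : Set E) := fun hc => by
  obtain ⟨ℓ, m, hcm, heq, -⟩ := h τ hτ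
  exact hcm.ne (heq c hc)

omit [DecidableEq E] in
/-- The apex is not a vertex of a visible complex. [folklore] -/
theorem apex_notMem (h : VisibleFrom c ℬ) {τ : Finset E} (hτ : τ ∈ ℬ.faces) : c ∉ τ := fun hc =>
  h.apex_notMem_convexHull hτ (subset_convexHull ℝ _ (Finset.mem_coe.2 hc))

omit [DecidableEq E] in
/-- The apex is off the affine span of every face. [folklore] -/
theorem apex_notMem_affineSpan (h : VisibleFrom c ℬ) {τ : Finset E} (hτ : τ ∈ ℬ.faces) :
    c ∉ affineSpan ℝ (τ : Set E) := fun hc => by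
  obtain ⟨ℓ, m, hcm, heq, -⟩ := h τ hτ
  -- `ℓ = m` on `τ`, hence on its affine span
  have hle : affineSpan ℝ (τ : Set E) ≤ (AffineSubspace.comap ℓ (AffineSubspace.mk' (m : ℝ) ⊥)) := by
    refine affineSpan_le.2 fun x hx => ?_
    rw [AffineSubspace.mem_coe, AffineSubspace.mem_comap, AffineSubspace.mem_mk', vsub_eq_sub,
      Submodule.mem_bot, sub_eq_zero]
    exact heq x (subset_convexHull ℝ _ hx)
  have h' := hle hc
  rw [AffineSubspace.mem_comap, AffineSubspace.mem_mk', vsub_eq_sub, Submodule.mem_bot,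
    sub_eq_zero] at h'
  exact hcm.ne h'

omit [DecidableEq E] in
/-- **The parameter on segments from the apex is unique**: if
`(1 - s) c + s y = (1 - s') c + s' y'` with `y, y'` on faces of a visible complex and
`s, s' ∈ (0, 1]`, then `s = s'` (and so `y = y'`). [folklore] -/
theorem param_unique (h : VisibleFrom c ℬ) {τ τ' : Finset E} (hτ : τ ∈ ℬ.faces) (hτ' : τ' ∈ ℬ.faces)
    {y y' : E} (hy : y ∈ convexHull ℝ (τ : Set E)) (hy' : y' ∈ convexHull ℝ (τ' : Set E))
    {s s' : ℝ} (hs : 0 < s) (hs' : 0 < s')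
    (heq : (1 - s) • c + s • y = (1 - s') • c + s' • y') : s = s' := by
  -- evaluate the functional of `τ` and of `τ'` on both sides
  obtain ⟨ℓ, m, hcm, hℓτ, hℓle⟩ := h τ hτ
  obtain ⟨ℓ', m', hcm', hℓτ', hℓle'⟩ := h τ' hτ'
  have hev : ∀ (φ : E →ᵃ[ℝ] ℝ) (t : ℝ) (z : E), φ ((1 - t) • c + t • z) = (1 - t) * φ c + t * φ z :=
    fun φ t z => by
      have h := (AffineMap.lineMap_apply_module c z t).symm
      rw [h, AffineMap.apply_lineMap, AffineMap.lineMap_apply_module, smul_eq_mul, smul_eq_mul]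
  have h1 := congrArg ℓ heq
  rw [hev, hev, hℓτ y hy] at h1
  have h2 := congrArg ℓ' heq
  rw [hev, hev, hℓτ' y' hy'] at h2
  have hy'le : ℓ y' ≤ m := hℓle τ' hτ' y' hy'
  have hyle : ℓ' y ≤ m' := hℓle' τ hτ y hy
  -- `(1-s) ℓ c + s m = (1-s') ℓ c + s' ℓ y' ≤ (1-s') ℓ c + s' m` gives `s ≤ s'`, symmetrically
  by_contra hne
  rcases lt_or_gt_of_ne hne with hlt | hlt
  · nlinarith
  · nlinarith

/-- **Cones from a visible apex meet as cones.** [folklore] -/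
theorem convexHull_insert_inter_subset (h : VisibleFrom c ℬ) {τ τ' : Finset E} (hτ : τ ∈ ℬ.faces)
    (hτ' : τ' ∈ ℬ.faces) :
    convexHull ℝ (↑(insert c τ) : Set E) ∩ convexHull ℝ (↑(insert c τ') : Set E) ⊆
      convexHull ℝ (insert c ((↑τ : Set E) ∩ ↑τ')) := by
  classical
  intro p hp
  have hdecomp : ∀ {σ : Finset E}, σ ∈ ℬ.faces → p ∈ convexHull ℝ (↑(insert c σ) : Set E) →
      ∃ y ∈ convexHull ℝ (σ : Set E), ∃ s ∈ Icc (0 : ℝ) 1, p = (1 - s) • c + s • y := by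
    intro σ hσ hpσ
    rw [Finset.coe_insert, convexHull_insert (Finset.coe_nonempty.2 (ℬ.nonempty_of_mem_faces hσ)),
      convexJoin_singleton_left] at hpσ
    obtain ⟨y, hy, hpy⟩ := mem_iUnion₂.1 hpσ
    obtain ⟨s, hs, rfl⟩ := (segment_eq_image ℝ c y ▸ hpy :
      p ∈ (fun θ : ℝ => (1 - θ) • c + θ • y) '' Icc 0 1)
    exact ⟨y, hy, s, hs, rfl⟩
  obtain ⟨y, hy, s, hs, hpy⟩ := hdecomp hτ hp.1
  obtain ⟨y', hy', s', hs', hpy'⟩ := hdecomp hτ' hp.2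
  rcases hs.1.eq_or_lt with rfl | hs0
  · rw [hpy]; simp only [sub_zero, one_smul, zero_smul, add_zero]
    exact subset_convexHull ℝ _ (mem_insert c _)
  rcases hs'.1.eq_or_lt with rfl | hs'0
  · rw [hpy']; simp only [sub_zero, one_smul, zero_smul, add_zero]
    exact subset_convexHull ℝ _ (mem_insert c _)
  have hss' : s = s' := h.param_unique hτ hτ' hy hy' hs0 hs'0 (hpy ▸ hpy')
  subst hss'
  have hyy : y = y' := by
    have h' : s • y = s • y' := add_left_cancel (hpy ▸ hpy')
    exact smul_right_injective E hs0.ne' h'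
  subst hyy
  have hyi : y ∈ convexHull ℝ ((↑τ : Set E) ∩ ↑τ') := by
    rw [← ℬ.convexHull_inter_convexHull hτ hτ']
    exact ⟨hy, hy'⟩
  rw [hpy]
  have hseg : segment ℝ c y ⊆ convexHull ℝ (insert c ((↑τ : Set E) ∩ ↑τ')) :=
    (convex_convexHull ℝ _).segment_subset (subset_convexHull ℝ _ (mem_insert c _))
      (convexHull_mono (subset_insert c _) hyi)
  exact hseg ⟨1 - s, s, by linarith [hs.2], hs.1, by ring, rfl⟩

/-- **A cone meets the base only in its base face.** [folklore] -/
theorem convexHull_insert_inter_base_subset (h : VisibleFrom c ℬ) {τ τ' : Finset E}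
    (hτ : τ ∈ ℬ.faces) (hτ' : τ' ∈ ℬ.faces) :
    convexHull ℝ (↑(insert c τ) : Set E) ∩ convexHull ℝ (τ' : Set E) ⊆
      convexHull ℝ ((↑τ : Set E) ∩ ↑τ') := by
  intro p hp
  obtain ⟨ℓ', m', hcm', hℓτ', hℓle'⟩ := h τ' hτ'
  rw [Finset.coe_insert, convexHull_insert (Finset.coe_nonempty.2 (ℬ.nonempty_of_mem_faces hτ)),
    convexJoin_singleton_left] at hp
  obtain ⟨y, hy, hpy⟩ := mem_iUnion₂.1 hp.1
  obtain ⟨s, hs, rfl⟩ := (segment_eq_image ℝ c y ▸ hpy :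
    p ∈ (fun θ : ℝ => (1 - θ) • c + θ • y) '' Icc 0 1)
  -- `ℓ' p = m'` forces `s = 1`
  have hev : ℓ' ((1 - s) • c + s • y) = (1 - s) * ℓ' c + s * ℓ' y := by
    have h := (AffineMap.lineMap_apply_module c y s).symm
    rw [h, AffineMap.apply_lineMap, AffineMap.lineMap_apply_module, smul_eq_mul, smul_eq_mul]
  have hpm : ℓ' ((1 - s) • c + s • y) = m' := hℓτ' _ hp.2
  have hyle : ℓ' y ≤ m' := hℓle' τ hτ y hy
  have hs1 : s = 1 := by
    by_contra hne
    have hlt : s < 1 := lt_of_le_of_ne hs.2 hne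
    rw [hev] at hpm
    have h1 : (1 - s) * ℓ' c < (1 - s) * m' := mul_lt_mul_of_pos_left hcm' (by linarith)
    have h2 : s * ℓ' y ≤ s * m' := mul_le_mul_of_nonneg_left hyle hs.1
    linarith
  subst hs1
  simp only [sub_self, zero_smul, one_smul, zero_add] at hp ⊢
  rw [← ℬ.convexHull_inter_convexHull hτ hτ']
  exact ⟨hy, hp.2⟩

end VisibleFrom

/-- **The cone complex** over a complex visible from the apex `c`: faces are the faces of the
base, their cones `{c} ∪ τ`, and the apex `{c}`. [folklore] -/
def coneComplex (c : E) (ℬ : Geometry.SimplicialComplex ℝ E) (h : VisibleFrom c ℬ) :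
    Geometry.SimplicialComplex ℝ E where
  faces := ℬ.faces ∪ (insert c) '' ℬ.faces ∪ {{c}}
  isRelLowerSet_faces := by
    classical
    intro s hs
    refine ⟨?_, fun t hts htne => ?_⟩
    · rcases hs with (hs | ⟨τ, hτ, rfl⟩) | hs
      · exact ℬ.nonempty_of_mem_faces hs
      · exact Finset.insert_nonempty c τ
      · rw [mem_singleton_iff.1 hs]; exact Finset.singleton_nonempty c
    · rcases hs with (hs | ⟨τ, hτ, rfl⟩) | hs
      · exact Or.inl (Or.inl (ℬ.down_closed hs hts htne))
      · by_cases hct : c ∈ t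
        · rcases (t.erase c).eq_empty_or_nonempty with h0 | hne
          · have : t = {c} := by
              rw [← Finset.insert_erase hct, h0]; rfl
            exact Or.inr (mem_singleton_iff.2 this)
          · have hsub : t.erase c ⊆ τ := fun x hx => by
              have hx' := Finset.mem_erase.1 hx
              rcases Finset.mem_insert.1 (hts hx'.2) with h' | h'
              · exact absurd h' hx'.1
              · exact h'
            refine Or.inl (Or.inr ⟨t.erase c, ℬ.down_closed hτ hsub hne, ?_⟩)
            exact Finset.insert_erase hct
        · have hsub : t ⊆ τ := fun x hx => by
            rcases Finset.mem_insert.1 (hts hx) with h' | h'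
            · exact absurd (h' ▸ hx) hct
            · exact h'
          exact Or.inl (Or.inl (ℬ.down_closed hτ hsub htne))
      · rw [mem_singleton_iff.1 hs] at hts
        have : t = {c} := Finset.Subset.antisymm hts (Finset.singleton_subset_iff.2
          (by obtain ⟨x, hx⟩ := htne; rwa [Finset.mem_singleton.1 (hts hx)] at hx))
        exact Or.inr (mem_singleton_iff.2 this)
  indep := by
    classical
    intro s hs
    rcases hs with (hs | ⟨τ, hτ, rfl⟩) | hs
    · exact ℬ.indep hs
    · have h1 : AffIndOn (id : E → E) τ := affIndOn_iff.2 (ℬ.indep hτ)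
      have h2 : (id : E → E) c ∉ affineSpan ℝ (id '' (τ : Set E)) := by
        rw [image_id, id]; exact h.apex_notMem_affineSpan hτ
      exact affIndOn_iff.1 (h1.insert_of_notMem_affineSpan (h.apex_notMem hτ) h2)
    · rw [mem_singleton_iff.1 hs]
      exact affineIndependent_of_subsingleton ℝ _
  inter_subset_convexHull := by
    classical
    intro s t hs ht
    have hpt : ∀ {p : E}, p ∈ convexHull ℝ (↑({c} : Finset E) : Set E) → p = c := fun {p} hp => by
      rwa [Finset.coe_singleton, convexHull_singleton, mem_singleton_iff] at hp
    have hcmem : c ∈ convexHull ℝ (↑({c} : Finset E) : Set E) := by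
      rw [Finset.coe_singleton, convexHull_singleton]; exact mem_singleton c
    rcases hs with (hs | ⟨σ, hσ, rfl⟩) | hs <;> rcases ht with (ht | ⟨τ, hτ, rfl⟩) | ht
    · -- base / base
      exact ℬ.inter_subset_convexHull hs ht
    · -- base / cone
      intro p hp
      have hp' := h.convexHull_insert_inter_base_subset hτ hs ⟨hp.2, hp.1⟩
      rwa [Finset.coe_insert, inter_insert_of_notMem (fun hc => h.apex_notMem hs (Finset.mem_coe.1 hc)),
        inter_comm]
    · -- base / apex
      rw [mem_singleton_iff.1 ht]
      intro p hp
      exact absurd (hpt hp.2 ▸ hp.1) (h.apex_notMem_convexHull hs)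
    · -- cone / base
      intro p hp
      have hp' := h.convexHull_insert_inter_base_subset hσ ht hp
      rwa [Finset.coe_insert, insert_inter_of_notMem (fun hc => h.apex_notMem ht (Finset.mem_coe.1 hc))]
    · -- cone / cone
      intro p hp
      have hp' := h.convexHull_insert_inter_subset hσ hτ hp
      rwa [Finset.coe_insert, Finset.coe_insert, ← insert_inter_distrib]
    · -- cone / apex
      rw [mem_singleton_iff.1 ht]
      intro p hp
      rw [hpt hp.2, Finset.coe_insert, Finset.coe_singleton,
        inter_eq_right.2 (singleton_subset_iff.2 (mem_insert c _)), convexHull_singleton]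
      exact mem_singleton c
    · -- apex / base
      rw [mem_singleton_iff.1 hs]
      intro p hp
      exact absurd (hpt hp.1 ▸ hp.2) (h.apex_notMem_convexHull ht)
    · -- apex / cone
      rw [mem_singleton_iff.1 hs]
      intro p hp
      rw [hpt hp.1, Finset.coe_singleton, Finset.coe_insert,
        inter_eq_left.2 (singleton_subset_iff.2 (mem_insert c _)), convexHull_singleton]
      exact mem_singleton c
    · -- apex / apex
      rw [mem_singleton_iff.1 hs, mem_singleton_iff.1 ht]
      intro p hp
      rw [inter_self]
      exact hp.1

/-- The faces of the cone complex. [folklore] -/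
theorem coneComplex_faces (c : E) (ℬ : Geometry.SimplicialComplex ℝ E) (h : VisibleFrom c ℬ) :
    (coneComplex c ℬ h).faces = ℬ.faces ∪ (insert c) '' ℬ.faces ∪ {{c}} := rfl

/-- The base is a subcomplex of the cone complex. [folklore] -/
theorem subset_coneComplex_faces (c : E) (ℬ : Geometry.SimplicialComplex ℝ E) (h : VisibleFrom c ℬ) :
    ℬ.faces ⊆ (coneComplex c ℬ h).faces := fun _ hτ => Or.inl (Or.inl hτ)

/-- Cones over base faces are faces of the cone complex. [folklore] -/
theorem insert_mem_coneComplex_faces {c : E} {ℬ : Geometry.SimplicialComplex ℝ E} (h : VisibleFrom c ℬ)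
    {τ : Finset E} (hτ : τ ∈ ℬ.faces) : insert c τ ∈ (coneComplex c ℬ h).faces :=
  Or.inl (Or.inr ⟨τ, hτ, rfl⟩)

/-- The cone complex is finite if the base is. [folklore] -/
theorem coneComplex_faces_finite {c : E} {ℬ : Geometry.SimplicialComplex ℝ E} (h : VisibleFrom c ℬ)
    (hfin : ℬ.faces.Finite) : (coneComplex c ℬ h).faces.Finite :=
  (hfin.union (hfin.image _)).union (finite_singleton _)

/-- **The underlying space of the cone complex** is the cone over the base: the apex together
with all segments from the apex to the base. [folklore] -/
theorem coneComplex_space (c : E) (ℬ : Geometry.SimplicialComplex ℝ E) (h : VisibleFrom c ℬ) :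
    (coneComplex c ℬ h).space = {c} ∪ ⋃ τ ∈ ℬ.faces, convexHull ℝ (↑(insert c τ) : Set E) := by
  classical
  apply Subset.antisymm
  · intro x hx
    obtain ⟨s, hs, hxs⟩ := Geometry.SimplicialComplex.mem_space_iff.1 hx
    rcases hs with (hs | ⟨τ, hτ, rfl⟩) | hs
    · refine Or.inr (mem_iUnion₂.2 ⟨s, hs, convexHull_mono ?_ hxs⟩)
      rw [Finset.coe_insert]; exact subset_insert c _
    · exact Or.inr (mem_iUnion₂.2 ⟨τ, hτ, hxs⟩)
    · rw [mem_singleton_iff.1 hs, Finset.coe_singleton, convexHull_singleton] at hxs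
      exact Or.inl hxs
  · rintro x (hx | hx)
    · rw [mem_singleton_iff.1 hx]
      refine Geometry.SimplicialComplex.mem_space_iff.2 ⟨{c}, Or.inr (mem_singleton _), ?_⟩
      rw [Finset.coe_singleton, convexHull_singleton]; exact mem_singleton c
    · obtain ⟨τ, hτ, hxτ⟩ := mem_iUnion₂.1 hx
      exact Geometry.SimplicialComplex.mem_space_iff.2 ⟨insert c τ, insert_mem_coneComplex_faces h hτ, hxτ⟩

omit [DecidableEq E] in
/-- **A complex in an affine subspace is visible from any apex off it.** [folklore] -/
theorem visibleFrom_of_subset_affineSubspace {P : AffineSubspace ℝ E}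
    {ℬ : Geometry.SimplicialComplex ℝ E} (hℬ : ∀ τ ∈ ℬ.faces, ((τ : Finset E) : Set E) ⊆ P)
    {c : E} (hc : c ∉ P) : VisibleFrom c ℬ := by
  intro τ hτ
  -- a linear functional vanishing on the direction of `P` with value `-1` at `c - p₀`
  obtain ⟨p₀, hp₀⟩ : (P : Set E).Nonempty := by
    obtain ⟨x, hx⟩ := ℬ.nonempty_of_mem_faces hτ
    exact ⟨x, hℬ τ hτ (Finset.mem_coe.2 hx)⟩
  have hv : c - p₀ ∉ P.direction := fun hd => hc (by
    have := AffineSubspace.vadd_mem_of_mem_direction hd hp₀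
    rwa [vadd_eq_add, sub_add_cancel] at this)
  obtain ⟨f, hf0, hfbot⟩ := P.direction.exists_dual_map_eq_bot_of_notMem hv inferInstance
  have hfP : ∀ v ∈ P.direction, f v = 0 := fun v hv => by
    have h : f v ∈ Submodule.map f P.direction := Submodule.mem_map_of_mem hv
    rwa [hfbot, Submodule.mem_bot] at h
  set g : Module.Dual ℝ E := (-(f (c - p₀))⁻¹) • f with hg
  have hgc : g (c - p₀) = -1 := by
    rw [hg, LinearMap.smul_apply, smul_eq_mul, neg_mul, inv_mul_cancel₀ hf0]
  set ℓ : E →ᵃ[ℝ] ℝ := (g : E →ₗ[ℝ] ℝ).toAffineMap + AffineMap.const ℝ E (-(g p₀)) with hℓ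
  have hℓapp : ∀ x, ℓ x = g (x - p₀) := fun x => by
    simp only [hℓ, AffineMap.coe_add, AffineMap.coe_const, Pi.add_apply, Function.const_apply,
      LinearMap.coe_toAffineMap, map_sub]
    ring
  have hℓP : ∀ x ∈ (P : Set E), ℓ x = 0 := fun x hx => by
    rw [hℓapp, hg, LinearMap.smul_apply, smul_eq_mul, hfP (x - p₀) ?_, mul_zero]
    have h := AffineSubspace.vsub_mem_direction hx hp₀
    rwa [vsub_eq_sub] at h
  have hconvP : ∀ σ ∈ ℬ.faces, convexHull ℝ (σ : Set E) ⊆ (P : Set E) := fun σ hσ =>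
    convexHull_min (hℬ σ hσ) P.convex
  refine ⟨ℓ, 0, ?_, fun x hx => hℓP x (hconvP τ hτ hx), fun τ' hτ' x hx => (hℓP x (hconvP τ' hτ' hx)).le⟩
  rw [hℓapp, hgc]; norm_num

end Literature.Topology.FourManifolds
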